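import Literature.Probability.Percolation.LonePortSumGeneral
import Literature.Probability.LatticeModels.SahiThirdOrderCorrelation
import HarnessLib

/-!
# Sahi's `E₃ ≥ 0` for `(D[P|Q], {s ↮ X}, D[P'|Q'])` with `Q, Q' ⊆ X` on EVERY finite weighted graph — the cluster-Markov / BHK criterion

Support file (prover prim-l12-p1 gen 2, P1 line; `--supports stmt-CriticalPhenomena-4575`).  No named facts, no sorries, no
`native_decide`.  New mathematics (not in print); the percolation inputs are the tree theorems of van den Berg–Häggström–Kahn 2006
(`BHK2006_clusterConditionalPositiveAssociation_holds` = Thm 1.3, and the block independence `BHK2006.sum_cond_cluster_sdiff` =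
their display (10)) and the conditional-Harris reduction of Sahi's functional (`prodBernoulli_sahiE3_nonneg_of_condHarris_lower`).

THEOREM (`sahiE3_sep_notReach_sep_nonneg`).  For Bernoulli bond percolation with arbitrary edge weights on a finite vertex set, a
vertex `s`, a vertex set `X`, and vertex sets `P, Q, P', Q'` with `Q ⊆ X` and `Q' ⊆ X`:
    `E₃( D[P|Q], D[P'|Q'], {s ↮ X} ) ≥ 0`,   `D[P|Q] = {no open path from P to Q}`.
This is a criterion closing 27 of the 37 'unimplied' S₄-orbits of the four-point decreasing cubic frontier (prim-masterthm-p1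
FRONTIER-4PT.md / `…FrontierDecRowsLeFive`, there certified for `n ≤ 5` only) for every `n` — see the companion file
`…FrontierDecRowsClusterMarkov` for the 27 rows; the one-source rows (`…FrontierDecRowsOneSource`) are the case `P = P' = {s}`.

PROOF.  Write `D = {s ↮ X}`, `W̄ = W̄(C_s)` the pairs meeting the cluster of `s`.  (1) Given `{C_s = W}` the configuration off `W̄` is a
fresh product configuration (display (10)); on `D`, since `Q ⊆ X` is not reached from `s`, the event `D[P|Q]` is read off `ω ∖ W̄`
(`reachable_sdiff_bar_iff`), so `E[1_A 1_C | C_s] ≥ E[1_A | C_s]·E[1_C | C_s]` by Harris in the fresh configuration (both decreasing);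
(2) `ψ_A(W) = E[1_A | C_s = W] = P(P ↮ Q off W̄(W))` is INCREASING in `W`, likewise `ψ_C`, so by BHK Thm 1.3 (the cluster `C_s` is
positively associated given `{s ↮ X}`) `μ(D)·E[1_D ψ_A ψ_C] ≥ E[1_D ψ_A]·E[1_D ψ_C] = μ(A ∩ D)·μ(C ∩ D)`.  Hence `A, C` are positively
correlated given `D` (`twoLocal_posCorrelation`, stated for two bounded antitone local statistics), and Sahi's `E₃(A, C, D)` dominates
that conditional covariance after three Harris steps.
-/

noncomputable section

namespace Summit.CriticalPhenomena.PercolationContinuityZ3.Theorems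

namespace ClusterMarkovE3

open MeasureTheory Literature.Probability.Percolation Literature.Probability.LatticeModels
open BHK2006 DecisionTree LonePortSum LonePortSumGeneral
open scoped Classical

variable {V : Type*} [Fintype V]

/-- **Two local decreasing statistics are positively correlated given `{s ↮ X}`.**  For `s ∉ X` and bounded antitone
`G₁, G₂ ≤ 1` with the locality property `Gᵢ(ω ∖ W̄(C_s ω)) = Gᵢ(ω)` on `D_X = {s ↮ X}`:
`(∫_{D_X} G₁)(∫_{D_X} G₂) ≤ μ(D_X) · ∫_{D_X} G₁ G₂` (block independence off the cluster + Harris in the fresh configuration +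
BHK Thm 1.3 for the two increasing cluster statistics `W ↦ E[Gᵢ(η ∖ W̄(W))]`). [this work] -/
theorem twoLocal_posCorrelation (w : Sym2 V → unitInterval) (s : V) (X : Set V) (hs : s ∉ X)
    (G₁ G₂ : BondConfig V → ℝ) (hG₁ : Antitone G₁) (hG₂ : Antitone G₂)
    (h₁1 : ∀ ω, G₁ ω ≤ 1) (h₂1 : ∀ ω, G₂ ω ≤ 1)
    (hloc₁ : ∀ ω : BondConfig V, (∀ x ∈ X, ¬ (openGraph ω).Reachable s x) →
      G₁ (ω \ {e | ∃ v ∈ e, v = s ∨ ∃ e' ∈ openEdgeCluster ω s, v ∈ e'}) = G₁ ω)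
    (hloc₂ : ∀ ω : BondConfig V, (∀ x ∈ X, ¬ (openGraph ω).Reachable s x) →
      G₂ (ω \ {e | ∃ v ∈ e, v = s ∨ ∃ e' ∈ openEdgeCluster ω s, v ∈ e'}) = G₂ ω) :
    (∫ ω in {ω : BondConfig V | ∀ x ∈ X, ¬ (openGraph ω).Reachable s x}, G₁ ω ∂(prodBernoulli w)) *
      (∫ ω in {ω : BondConfig V | ∀ x ∈ X, ¬ (openGraph ω).Reachable s x}, G₂ ω ∂(prodBernoulli w)) ≤
    (prodBernoulli w).real {ω : BondConfig V | ∀ x ∈ X, ¬ (openGraph ω).Reachable s x} *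
      ∫ ω in {ω : BondConfig V | ∀ x ∈ X, ¬ (openGraph ω).Reachable s x}, G₁ ω * G₂ ω ∂(prodBernoulli w) := by
  classical
  set DX : Set (BondConfig V) := {ω | ∀ x ∈ X, ¬ (openGraph ω).Reachable s x} with hDX
  set w' : Sym2 V → ℝ := fun e => (w e : ℝ) with hw'
  have hw0 : ∀ e, 0 ≤ w' e := fun e => (w e).2.1
  have hw1 : ∀ e, w' e ≤ 1 := fun e => (w e).2.2
  have hm : ∑ ω, weight w' ω = 1 := by
    have h1 := integral_prodBernoulli_eq_sum w fun _ => (1 : ℝ)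
    simp only [integral_const, probReal_univ, smul_eq_mul, mul_one] at h1
    exact h1.symm
  -- `1_{D_X} = NX(C_s)`
  set NX : Set (Sym2 V) → ℝ := fun C => if ∀ x ∈ X, ¬ (x = s ∨ ∃ e ∈ C, x ∈ e) then 1 else 0
    with hNX
  have hNX0 : ∀ C, 0 ≤ NX C := fun C => by
    simp only [hNX]; split_ifs <;> norm_num
  have hind : ∀ ω : BondConfig V, ind DX ω = NX (openEdgeCluster ω s) := by
    intro ω
    by_cases hω : ω ∈ DX
    · have hω' : ∀ x ∈ X, ¬ (openGraph ω).Reachable s x := hω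
      have h1 : ∀ x ∈ X, ¬ (x = s ∨ ∃ e ∈ openEdgeCluster ω s, x ∈ e) := fun x hx h =>
        hω' x hx ((reachable_iff_exists_mem_openEdgeCluster ω s x).2 h)
      rw [ind_of_mem hω, hNX]
      simp only [if_pos h1]
    · have hω' : ∃ x ∈ X, (openGraph ω).Reachable s x := by
        by_contra hcon
        exact hω fun x hx hr => hcon ⟨x, hx, hr⟩
      obtain ⟨x, hx, hr⟩ := hω'
      have h1 : ¬ ∀ x ∈ X, ¬ (x = s ∨ ∃ e ∈ openEdgeCluster ω s, x ∈ e) := fun h =>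
        h x hx ((reachable_iff_exists_mem_openEdgeCluster ω s x).1 hr)
      rw [ind_of_not_mem hω, hNX]
      simp only [if_neg h1]
  -- the bar sets and the conditional means
  set bar : Set (Sym2 V) → Set (Sym2 V) := fun W => {e : Sym2 V | ∃ v ∈ e, v = s ∨ ∃ e' ∈ W, v ∈ e'} with hbar
  have hbar_mono : Monotone bar := bar_mono s
  set ψ₁ : Set (Sym2 V) → ℝ := fun W => ∑ η, weight w' η * G₁ (η \ bar W) with hψ₁
  set ψ₂ : Set (Sym2 V) → ℝ := fun W => ∑ η, weight w' η * G₂ (η \ bar W) with hψ₂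
  set ψ₁₂ : Set (Sym2 V) → ℝ := fun W => ∑ η, weight w' η * (G₁ (η \ bar W) * G₂ (η \ bar W)) with hψ₁₂
  have hψ₁mono : Monotone ψ₁ := by
    intro W W' hWW'
    refine Finset.sum_le_sum fun η _ => mul_le_mul_of_nonneg_left ?_ (weight_nonneg hw0 hw1 η)
    exact hG₁ (Set.sdiff_subset_sdiff_right (hbar_mono hWW'))
  have hψ₂mono : Monotone ψ₂ := by
    intro W W' hWW'
    refine Finset.sum_le_sum fun η _ => mul_le_mul_of_nonneg_left ?_ (weight_nonneg hw0 hw1 η)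
    exact hG₂ (Set.sdiff_subset_sdiff_right (hbar_mono hWW'))
  -- Harris in the fresh configuration: `ψ₁ ψ₂ ≤ ψ₁₂`
  have hHarris : ∀ W, ψ₁ W * ψ₂ W ≤ ψ₁₂ W := by
    intro W
    have hf : Antitone (fun η : Set (Sym2 V) => G₁ (η \ bar W)) := fun a b hab =>
      hG₁ (Set.sdiff_subset_sdiff_left hab)
    have hg : Antitone (fun η : Set (Sym2 V) => G₂ (η \ bar W)) := fun a b hab =>
      hG₂ (Set.sdiff_subset_sdiff_left hab)
    exact harris_anti_anti hw0 hw1 hm hf hg (fun a => h₁1 _) (fun a => h₂1 _)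
  -- pointwise identities on `D_X` (locality)
  have hptw₁ : ∀ ω : BondConfig V, G₁ ω * ind DX ω =
      NX (openEdgeCluster ω s) * G₁ (ω \ bar (openEdgeCluster ω s)) := by
    intro ω
    rw [hind ω]
    by_cases hω : ω ∈ DX
    · rw [hloc₁ ω hω, mul_comm]
    · have h0 : NX (openEdgeCluster ω s) = 0 := by rw [← hind ω, ind_of_not_mem hω]
      rw [h0, zero_mul, mul_zero]
  have hptw₂ : ∀ ω : BondConfig V, G₂ ω * ind DX ω =
      NX (openEdgeCluster ω s) * G₂ (ω \ bar (openEdgeCluster ω s)) := by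
    intro ω
    rw [hind ω]
    by_cases hω : ω ∈ DX
    · rw [hloc₂ ω hω, mul_comm]
    · have h0 : NX (openEdgeCluster ω s) = 0 := by rw [← hind ω, ind_of_not_mem hω]
      rw [h0, zero_mul, mul_zero]
  have hptw₁₂ : ∀ ω : BondConfig V, G₁ ω * G₂ ω * ind DX ω =
      NX (openEdgeCluster ω s) * (G₁ (ω \ bar (openEdgeCluster ω s)) * G₂ (ω \ bar (openEdgeCluster ω s))) := by
    intro ω
    rw [hind ω]
    by_cases hω : ω ∈ DX
    · rw [hloc₁ ω hω, hloc₂ ω hω, mul_comm]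
    · have h0 : NX (openEdgeCluster ω s) = 0 := by rw [← hind ω, ind_of_not_mem hω]
      rw [h0, zero_mul, mul_zero]
  -- display (10) three times
  have e1 := sum_cond_cluster_sdiff w' hm s (fun C ξ => NX C * G₁ ξ)
  have e2 := sum_cond_cluster_sdiff w' hm s (fun C ξ => NX C * G₂ ξ)
  have e12 := sum_cond_cluster_sdiff w' hm s (fun C ξ => NX C * (G₁ ξ * G₂ ξ))
  have i1 : ∫ ω in DX, G₁ ω ∂(prodBernoulli w) = ∫ ω in DX, ψ₁ (openEdgeCluster ω s) ∂(prodBernoulli w) := by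
    rw [setIntegral_eq_sum w DX, setIntegral_eq_sum w DX]
    have lhs : ∑ ω, weight w' ω * (G₁ ω * ind DX ω) =
        ∑ ω, weight w' ω * ((fun C ξ => NX C * G₁ ξ) (openEdgeCluster ω s)
          (ω \ {e | ∃ v ∈ e, v = s ∨ ∃ e' ∈ openEdgeCluster ω s, v ∈ e'})) :=
      Finset.sum_congr rfl fun ω _ => by simp only; rw [hptw₁ ω]
    rw [lhs, e1]
    refine Finset.sum_congr rfl fun ω _ => ?_
    rw [hind ω, hψ₁]
    simp only [Finset.mul_sum, Finset.sum_mul]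
    refine Finset.sum_congr rfl fun η _ => ?_
    ring
  have i2 : ∫ ω in DX, G₂ ω ∂(prodBernoulli w) = ∫ ω in DX, ψ₂ (openEdgeCluster ω s) ∂(prodBernoulli w) := by
    rw [setIntegral_eq_sum w DX, setIntegral_eq_sum w DX]
    have lhs : ∑ ω, weight w' ω * (G₂ ω * ind DX ω) =
        ∑ ω, weight w' ω * ((fun C ξ => NX C * G₂ ξ) (openEdgeCluster ω s)
          (ω \ {e | ∃ v ∈ e, v = s ∨ ∃ e' ∈ openEdgeCluster ω s, v ∈ e'})) :=
      Finset.sum_congr rfl fun ω _ => by simp only; rw [hptw₂ ω]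
    rw [lhs, e2]
    refine Finset.sum_congr rfl fun ω _ => ?_
    rw [hind ω, hψ₂]
    simp only [Finset.mul_sum, Finset.sum_mul]
    refine Finset.sum_congr rfl fun η _ => ?_
    ring
  have i12 : ∫ ω in DX, ψ₁ (openEdgeCluster ω s) * ψ₂ (openEdgeCluster ω s) ∂(prodBernoulli w) ≤
      ∫ ω in DX, G₁ ω * G₂ ω ∂(prodBernoulli w) := by
    rw [setIntegral_eq_sum w DX, setIntegral_eq_sum w DX]
    have rhs : ∑ ω, weight w' ω * (G₁ ω * G₂ ω * ind DX ω) =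
        ∑ ω, weight w' ω * ((fun C ξ => NX C * (G₁ ξ * G₂ ξ)) (openEdgeCluster ω s)
          (ω \ {e | ∃ v ∈ e, v = s ∨ ∃ e' ∈ openEdgeCluster ω s, v ∈ e'})) :=
      Finset.sum_congr rfl fun ω _ => by simp only; rw [hptw₁₂ ω]
    rw [rhs, e12]
    refine Finset.sum_le_sum fun ω _ => ?_
    rw [hind ω]
    have hsplit : ∑ η, weight w' η * ((fun C ξ => NX C * (G₁ ξ * G₂ ξ)) (openEdgeCluster ω s)
          (η \ {e | ∃ v ∈ e, v = s ∨ ∃ e' ∈ openEdgeCluster ω s, v ∈ e'})) =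
        NX (openEdgeCluster ω s) * ψ₁₂ (openEdgeCluster ω s) := by
      rw [hψ₁₂]
      simp only [Finset.mul_sum]
      refine Finset.sum_congr rfl fun η _ => ?_
      ring
    rw [hsplit]
    have hle : ψ₁ (openEdgeCluster ω s) * ψ₂ (openEdgeCluster ω s) * NX (openEdgeCluster ω s) ≤
        NX (openEdgeCluster ω s) * ψ₁₂ (openEdgeCluster ω s) := by
      rw [mul_comm _ (NX _)]
      exact mul_le_mul_of_nonneg_left (hHarris _) (hNX0 _)
    exact mul_le_mul_of_nonneg_left hle (weight_nonneg hw0 hw1 ω)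
  -- BHK Thm 1.3 for the two increasing cluster statistics
  have h13 := BHK2006_clusterConditionalPositiveAssociation_holds V w s X ψ₁ ψ₂ hψ₁mono hψ₂mono hs
  rw [i1, i2]
  exact h13.trans (mul_le_mul_of_nonneg_left i12 measureReal_nonneg)

/-! ### Separation events and their locality -/

omit [Fintype V] in
/-- `D[P|Q]` is decreasing. [folklore] -/
theorem isLowerSet_sepEv (P Q : Set V) :
    IsLowerSet {ω : BondConfig V | ∀ p ∈ P, ∀ q ∈ Q, ¬ (openGraph ω).Reachable p q} := by
  intro ω ω' hle hω p hp q hq hreach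
  exact hω p hp q hq (hreach.mono (openGraph_mono hle))

omit [Fintype V] in
/-- `D[P|Q] = D[Q|P]`. [folklore] -/
theorem sepEv_comm (P Q : Set V) : {ω : BondConfig V | ∀ p ∈ P, ∀ q ∈ Q, ¬ (openGraph ω).Reachable p q} = {ω : BondConfig V | ∀ p ∈ Q, ∀ q ∈ P, ¬ (openGraph ω).Reachable p q} := by
  ext ω
  simp only [Set.mem_setOf_eq]
  constructor
  · intro h q hq p hp hr; exact h p hp q hq hr.symm
  · intro h p hp q hq hr; exact h q hq p hp hr.symm

omit [Fintype V] in
/-- `{s ↮ X} = D[{s}|X]`. [folklore] -/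
theorem sepEv_singleton (s : V) (X : Set V) :
    {ω : BondConfig V | ∀ p ∈ ({s} : Set V), ∀ q ∈ X, ¬ (openGraph ω).Reachable p q} = {ω : BondConfig V | ∀ x ∈ X, ¬ (openGraph ω).Reachable s x} := by
  ext ω; simp

omit [Fintype V] in
/-- **Locality**: on `{s ↮ X}`, an event `D[P|Q]` with `Q ⊆ X` is read off the configuration with the pairs meeting the cluster
of `s` deleted. [this work] -/
theorem ind_sepEv_sdiff_bar (P Q X : Set V) (s : V) (hQ : Q ⊆ X) (ω : BondConfig V)
    (hω : ∀ x ∈ X, ¬ (openGraph ω).Reachable s x) :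
    ind ({ω : BondConfig V | ∀ p ∈ P, ∀ q ∈ Q, ¬ (openGraph ω).Reachable p q}) (ω \ {e | ∃ v ∈ e, v = s ∨ ∃ e' ∈ openEdgeCluster ω s, v ∈ e'}) = ind ({ω : BondConfig V | ∀ p ∈ P, ∀ q ∈ Q, ¬ (openGraph ω).Reachable p q}) ω := by
  have key : (ω \ {e | ∃ v ∈ e, v = s ∨ ∃ e' ∈ openEdgeCluster ω s, v ∈ e'}) ∈ {ω : BondConfig V | ∀ p ∈ P, ∀ q ∈ Q, ¬ (openGraph ω).Reachable p q} ↔ ω ∈ {ω : BondConfig V | ∀ p ∈ P, ∀ q ∈ Q, ¬ (openGraph ω).Reachable p q} := by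
    simp only [Set.mem_setOf_eq]
    refine forall₂_congr fun p _ => forall₂_congr fun q hq => ?_
    rw [SimpleGraph.reachable_comm, reachable_sdiff_bar_iff (hω q (hQ hq)) p, SimpleGraph.reachable_comm]
  by_cases h : ω ∈ {ω : BondConfig V | ∀ p ∈ P, ∀ q ∈ Q, ¬ (openGraph ω).Reachable p q}
  · rw [ind_of_mem h, ind_of_mem (key.2 h)]
  · rw [ind_of_not_mem h, ind_of_not_mem (fun h' => h (key.1 h'))]

/-- `∫_D 1_A = μ(D ∩ A)` as used below. [folklore] -/
theorem setIntegral_ind_eq (w : Sym2 V → unitInterval) (D A : Set (BondConfig V)) :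
    ∫ ω in D, ind A ω ∂(prodBernoulli w) = (prodBernoulli w).real (D ∩ A) := by
  rw [setIntegral_eq_sum w D, measureReal_eq_sum w (D ∩ A)]
  refine Finset.sum_congr rfl fun ω _ => ?_
  rw [ind_inter, mul_comm (ind D ω)]

/-- **`D[P|Q]` and `D[P'|Q']` are positively correlated given `{s ↮ X}` when `Q, Q' ⊆ X`** (product form, no side conditions):
`μ(D_X ∩ D[P|Q]) · μ(D_X ∩ D[P'|Q']) ≤ μ(D_X) · μ(D_X ∩ D[P|Q] ∩ D[P'|Q'])`. [this work] -/
theorem sep_sep_posCorrelation_notReach (w : Sym2 V → unitInterval) (s : V) (X P Q P' Q' : Set V)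
    (hQ : Q ⊆ X) (hQ' : Q' ⊆ X) :
    (prodBernoulli w).real ({ω : BondConfig V | ∀ x ∈ X, ¬ (openGraph ω).Reachable s x} ∩ {ω : BondConfig V | ∀ p ∈ P, ∀ q ∈ Q, ¬ (openGraph ω).Reachable p q}) *
      (prodBernoulli w).real ({ω : BondConfig V | ∀ x ∈ X, ¬ (openGraph ω).Reachable s x} ∩ {ω : BondConfig V | ∀ p ∈ P', ∀ q ∈ Q', ¬ (openGraph ω).Reachable p q}) ≤
    (prodBernoulli w).real {ω : BondConfig V | ∀ x ∈ X, ¬ (openGraph ω).Reachable s x} *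
      (prodBernoulli w).real ({ω : BondConfig V | ∀ x ∈ X, ¬ (openGraph ω).Reachable s x} ∩
        ({ω : BondConfig V | ∀ p ∈ P, ∀ q ∈ Q, ¬ (openGraph ω).Reachable p q} ∩ {ω : BondConfig V | ∀ p ∈ P', ∀ q ∈ Q', ¬ (openGraph ω).Reachable p q})) := by
  classical
  by_cases hs : s ∈ X
  · have hempty : {ω : BondConfig V | ∀ x ∈ X, ¬ (openGraph ω).Reachable s x} = ∅ := by
      ext ω
      simp only [Set.mem_setOf_eq, Set.mem_empty_iff_false, iff_false, not_forall, not_not]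
      exact ⟨s, hs, SimpleGraph.Reachable.refl _⟩
    rw [hempty]
    simp
  have h := twoLocal_posCorrelation w s X hs (ind ({ω : BondConfig V | ∀ p ∈ P, ∀ q ∈ Q, ¬ (openGraph ω).Reachable p q})) (ind ({ω : BondConfig V | ∀ p ∈ P', ∀ q ∈ Q', ¬ (openGraph ω).Reachable p q}))
    (fun a b hab => ind_mono_lower (isLowerSet_sepEv P Q) hab)
    (fun a b hab => ind_mono_lower (isLowerSet_sepEv P' Q') hab)
    (fun ω => ind_le_one _ _) (fun ω => ind_le_one _ _)
    (fun ω hω => ind_sepEv_sdiff_bar P Q X s hQ ω hω) (fun ω hω => ind_sepEv_sdiff_bar P' Q' X s hQ' ω hω)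
  have hprod : (fun ω : BondConfig V => ind ({ω : BondConfig V | ∀ p ∈ P, ∀ q ∈ Q, ¬ (openGraph ω).Reachable p q}) ω * ind ({ω : BondConfig V | ∀ p ∈ P', ∀ q ∈ Q', ¬ (openGraph ω).Reachable p q}) ω) =
      fun ω => ind ({ω : BondConfig V | ∀ p ∈ P, ∀ q ∈ Q, ¬ (openGraph ω).Reachable p q} ∩ {ω : BondConfig V | ∀ p ∈ P', ∀ q ∈ Q', ¬ (openGraph ω).Reachable p q}) ω := funext fun ω => (ind_inter _ _ ω).symm
  rw [hprod, setIntegral_ind_eq, setIntegral_ind_eq, setIntegral_ind_eq] at h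
  exact h
where
  /-- indicator of a lower set is antitone -/
  ind_mono_lower {A : Set (BondConfig V)} (hA : IsLowerSet A) {a b : BondConfig V} (hab : a ≤ b) :
      ind A b ≤ ind A a := by
    by_cases hb : b ∈ A
    · rw [ind_of_mem hb, ind_of_mem (hA hab hb)]
    · rw [ind_of_not_mem hb]; exact ind_nonneg _ _

/-- **THEOREM (cluster-Markov / BHK criterion).**  For every finite weighted graph, vertex `s`, vertex set `X`, and vertex sets
`P, Q, P', Q'` with `Q ⊆ X`, `Q' ⊆ X`:  `0 ≤ E₃(D[P|Q], D[P'|Q'], {s ↮ X})`. [this work] -/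
theorem sahiE3_sep_sep_notReach_nonneg (w : Sym2 V → unitInterval) (s : V) (X P Q P' Q' : Set V)
    (hQ : Q ⊆ X) (hQ' : Q' ⊆ X) :
    0 ≤ sahiE3 (prodBernoulli w) ({ω : BondConfig V | ∀ p ∈ P, ∀ q ∈ Q, ¬ (openGraph ω).Reachable p q}) ({ω : BondConfig V | ∀ p ∈ P', ∀ q ∈ Q', ¬ (openGraph ω).Reachable p q})
      {ω : BondConfig V | ∀ x ∈ X, ¬ (openGraph ω).Reachable s x} := by
  have hD : IsLowerSet {ω : BondConfig V | ∀ x ∈ X, ¬ (openGraph ω).Reachable s x} := by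
    rw [← sepEv_singleton]; exact isLowerSet_sepEv _ _
  refine prodBernoulli_sahiE3_nonneg_of_condHarris_lower w (isLowerSet_sepEv P Q) (isLowerSet_sepEv P' Q') hD
    MeasurableSet.of_discrete MeasurableSet.of_discrete MeasurableSet.of_discrete ?_
  have h := sep_sep_posCorrelation_notReach w s X P Q P' Q' hQ hQ'
  rw [Set.inter_comm _ ({ω : BondConfig V | ∀ p ∈ P, ∀ q ∈ Q, ¬ (openGraph ω).Reachable p q}), Set.inter_comm _ ({ω : BondConfig V | ∀ p ∈ P', ∀ q ∈ Q', ¬ (openGraph ω).Reachable p q}), Set.inter_comm _ ({ω : BondConfig V | ∀ p ∈ P, ∀ q ∈ Q, ¬ (openGraph ω).Reachable p q} ∩ {ω : BondConfig V | ∀ p ∈ P', ∀ q ∈ Q', ¬ (openGraph ω).Reachable p q})] at h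
  exact h

/-- The same with the conditioning event in the MIDDLE slot and written as `D[{s}|X]`. [this work] -/
theorem sahiE3_sep_notReach_sep_nonneg (w : Sym2 V → unitInterval) (s : V) (X P Q P' Q' : Set V)
    (hQ : Q ⊆ X) (hQ' : Q' ⊆ X) :
    0 ≤ sahiE3 (prodBernoulli w) ({ω : BondConfig V | ∀ p ∈ P, ∀ q ∈ Q, ¬ (openGraph ω).Reachable p q}) ({ω : BondConfig V | ∀ p ∈ ({s} : Set V), ∀ q ∈ X, ¬ (openGraph ω).Reachable p q}) ({ω : BondConfig V | ∀ p ∈ P', ∀ q ∈ Q', ¬ (openGraph ω).Reachable p q}) := by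
  rw [sahiE3_comm₂₃, sepEv_singleton]
  exact sahiE3_sep_sep_notReach_nonneg w s X P Q P' Q' hQ hQ'

/-- The same with the conditioning event in the FIRST slot. [this work] -/
theorem sahiE3_notReach_sep_sep_nonneg (w : Sym2 V → unitInterval) (s : V) (X P Q P' Q' : Set V)
    (hQ : Q ⊆ X) (hQ' : Q' ⊆ X) :
    0 ≤ sahiE3 (prodBernoulli w) ({ω : BondConfig V | ∀ p ∈ ({s} : Set V), ∀ q ∈ X, ¬ (openGraph ω).Reachable p q}) ({ω : BondConfig V | ∀ p ∈ P, ∀ q ∈ Q, ¬ (openGraph ω).Reachable p q}) ({ω : BondConfig V | ∀ p ∈ P', ∀ q ∈ Q', ¬ (openGraph ω).Reachable p q}) := by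
  rw [sahiE3_comm₁₂]
  exact sahiE3_sep_notReach_sep_nonneg w s X P Q P' Q' hQ hQ'

end ClusterMarkovE3

end Summit.CriticalPhenomena.PercolationContinuityZ3.Theorems
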